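import Literature.MathematicalPhysics.KineticTheory.HardSphereBBGKYLiouvilleLipschitz
import Literature.MathematicalPhysics.KineticTheory.HardSphereBBGKYLiouvilleBoundary
import Mathlib.Analysis.Calculus.Rademacher
import Mathlib.MeasureTheory.Integral.IntervalIntegral.AbsolutelyContinuousFun
import HarnessLib

/-!
# The mild BBGKY identity at an intermediate level, with free boundary data

Eighth file of the proof of `Literature.MathematicalPhysics.KineticTheory.bbgky_hierarchy_of_liouville`
(**hilbert6.S07**; plan in `HardSphereBBGKYLiouvilleFlow`). For `1 ≤ s` tagged and `m ≥ 1`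
untagged hard spheres on the flat torus (`0 < ε ≤ 1/2`, flows `Φs`, `Φs1`, `ΦN` of `s`, `s+1`,
`s+m` particles, Lanford-class `W`) we produce (`exists_level_version`):

* a version `Fs : ℝ → Config s → ℝ` of the honest `s`-marginal `f^{(s)}(t) = (1_{good} W ∘ ΦN_{-t})^{(s)}`
  (`Fs t = f^{(s)}(t)` a.e. on `good_s` for every `t`), and
* boundary data `hb : ℝ → Config (s+1) → ℝ`, supported for all times in one null measurable set
  of contact configurations of the pair `(i₀, s+1)`,

such that the **Duhamel identity** `Fs t Z = Fs 0 (Φs_{-t} Z) + ∫_0^t (C_{s,s+1} hb(τ))(Φs_{τ-t} Z) dτ`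
holds at **every** good `Z` and every `t`. Construction: `ũ` the Lipschitz version of the marginal
along the tagged flow (`exists_lipschitz_marginal_flow`); `k(τ, Y) = limsup_n (n+1)(ũ(τ + 1/(n+1), Y) - ũ(τ, Y))`
(measurable in `Y`, equal to `∂_τ ũ` at points of differentiability, bounded by the Lipschitz
weight); `K(τ) = 1_{good} k(τ, Φs_{-τ} ·)` has the Gaussian envelope required by
`exists_boundaryData`, which gives `hb(τ)` with `C_{s,s+1} hb(τ) = 1_{Sbadᶜ} K(τ)`; `Fs` is the
Duhamel right-hand side. The a.e. agreement is the fundamental theorem of calculus for the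
Lipschitz function `ũ(·, Y)` (Rademacher, `AbsolutelyContinuousOnInterval.integral_deriv_eq_sub`),
after discarding the null set of `Y` whose orbit spends positive time in `Sbad`
(`ae_ae_flow_not_mem_torus`).

Theorems only; no definition and no named fact is introduced.

## References

* C. Cercignani, R. Illner, M. Pulvirenti, *The Mathematical Theory of Dilute Gases*, Springer
  (1994), Thm 4.3.1 (the hierarchy in mild form, for a.e. `z^s`).
* I. Gallagher, L. Saint-Raymond, B. Texier, *From Newton to Boltzmann*, EMS (2013),
  arXiv:1208.5753, (4.3.7)–(4.3.8).
-/

open MeasureTheory Set Filter Topology Metric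
open scoped ENNReal InnerProductSpace

namespace Literature.MathematicalPhysics.KineticTheory

open Literature.Analysis.FluidPDE

noncomputable section

variable {d : Type*} [Fintype d]

section Level

variable {ε β CW : ℝ} {s m : ℕ}

/-- The energy controls each speed: `e^{-(β/2) E(Y)} ≤ e^{-(β/4) ‖v_i‖²}` for `β ≥ 0`. [folklore] -/
theorem exp_neg_half_energy_le {n : ℕ} (hβ : 0 ≤ β) (Y : Config n d (UnitAddTorus d)) (i : Fin n) :
    Real.exp (-(β / 2) * configEnergy Y) ≤ Real.exp (-(β / 4) * ‖(Y i).2‖ ^ 2) := by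
  apply Real.exp_le_exp.2
  have h := norm_vel_sq_le_two_mul_configEnergy Y i
  nlinarith

/-- **The mild BBGKY identity at level `1 ≤ s ≤ N - 1` with free boundary data** (see the module
docstring). Hypotheses: flat torus, `0 < ε ≤ 1/2`, `0 < β`, `0 ≤ C_W`, `|W| ≤ C_W e^{-βE}`
measurable and integrable, `1 ≤ card d`, and the antipodal directions `σ`-null
(`reprSym (proj (εω)) ≠ εω`; automatic for `ε < 1/2`). [cite: CIP1994, Thm 4.3.1] -/
theorem exists_level_version (hε : 0 < ε) (hε2 : ε ≤ 1 / 2) (hβ : 0 < β) (hd : 1 ≤ Fintype.card d)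
    (hs : 1 ≤ s) (hm : 1 ≤ m)
    (hBadω : sphereMeasure {ω : sphere (0 : EuclideanSpace ℝ d) 1 |
      Torus.reprSym (Literature.Analysis.FunctionSpaces.Torus.proj (ε • (ω : EuclideanSpace ℝ d))) ≠
        ε • (ω : EuclideanSpace ℝ d)} = 0)
    (Φs : HardSphereFlow (Torus.geometry d) ε s) (ΦN : HardSphereFlow (Torus.geometry d) ε (s + m))
    {W : Config (s + m) d (UnitAddTorus d) → ℝ} (hW : Measurable W) (hWi : Integrable W)
    (hCW : 0 ≤ CW) (hWb : ∀ z, |W z| ≤ CW * Real.exp (-β * configEnergy z)) :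
    ∃ (Fs : ℝ → Config s d (UnitAddTorus d) → ℝ) (hb : ℝ → Config (s + 1) d (UnitAddTorus d) → ℝ)
      (H : Set (Config (s + 1) d (UnitAddTorus d))),
      MeasurableSet H ∧ volume H = 0 ∧ (∀ τ Z, hb τ Z ≠ 0 → Z ∈ H) ∧
      (∀ (t : ℝ) (Z : Config s d (UnitAddTorus d)), Z ∈ Φs.good →
        Fs t Z = Fs 0 (Φs.flow (-t) Z) +
          ∫ τ in (0 : ℝ)..t, bbgkyOp (Torus.geometry d) ε (s + m) s (hb τ) (Φs.flow (-(t - τ)) Z)) ∧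
      (∀ t : ℝ, ∀ᵐ Z : Config s d (UnitAddTorus d), Z ∈ Φs.good →
        Fs t Z = nthMarginal (s + m) s (ΦN.good.indicator fun z => W (ΦN.flow (-t) z)) Z) := by
  classical
  -- the tagged index carrying the boundary data
  set i₀ : Fin s := ⟨0, hs⟩ with hi₀
  /- ### the Lipschitz version of the marginal along the tagged flow -/
  obtain ⟨L, ut, hL0, hutm, hutL, hutae⟩ := exists_lipschitz_marginal_flow hε hε2 hβ Φs ΦN hW hWi hCW hWb
  /- ### the time derivative -/
  obtain ⟨k, hk⟩ : ∃ k : ℝ → Config s d (UnitAddTorus d) → ℝ, k = fun τ Y =>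
      limsup (fun n : ℕ => (ut (τ + 1 / ((n : ℝ) + 1)) Y - ut τ Y) * ((n : ℝ) + 1)) atTop := ⟨_, rfl⟩
  have hkm : ∀ τ, Measurable (k τ) := fun τ => by
    rw [hk]
    exact Measurable.limsup fun n => ((hutm _).sub (hutm _)).mul_const _
  -- the difference quotients are bounded by the Lipschitz weight
  have hquot : ∀ (τ : ℝ) (Y : Config s d (UnitAddTorus d)) (n : ℕ),
      |(ut (τ + 1 / ((n : ℝ) + 1)) Y - ut τ Y) * ((n : ℝ) + 1)| ≤ L * Real.exp (-(β / 2) * configEnergy Y) := by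
    intro τ Y n
    have hn : (0 : ℝ) < (n : ℝ) + 1 := by positivity
    have h := hutL Y (τ + 1 / ((n : ℝ) + 1)) τ
    rw [add_sub_cancel_left, abs_of_pos (by positivity : (0 : ℝ) < 1 / ((n : ℝ) + 1))] at h
    rw [abs_mul, abs_of_pos hn]
    calc |ut (τ + 1 / ((n : ℝ) + 1)) Y - ut τ Y| * ((n : ℝ) + 1)
        ≤ L * Real.exp (-(β / 2) * configEnergy Y) * (1 / ((n : ℝ) + 1)) * ((n : ℝ) + 1) := by gcongr
      _ = L * Real.exp (-(β / 2) * configEnergy Y) := by field_simp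
  have hkbd : ∀ τ Y, |k τ Y| ≤ L * Real.exp (-(β / 2) * configEnergy Y) := by
    intro τ Y
    rw [hk]
    simp only
    have hbdd : IsBoundedUnder (· ≤ ·) atTop fun n : ℕ => (ut (τ + 1 / ((n : ℝ) + 1)) Y - ut τ Y) * ((n : ℝ) + 1) :=
      isBoundedUnder_of ⟨L * Real.exp (-(β / 2) * configEnergy Y), fun n => (abs_le.1 (hquot τ Y n)).2⟩
    have hcobdd : IsCoboundedUnder (· ≤ ·) atTop fun n : ℕ => (ut (τ + 1 / ((n : ℝ) + 1)) Y - ut τ Y) * ((n : ℝ) + 1) :=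
      isCoboundedUnder_le_of_le atTop fun n => (abs_le.1 (hquot τ Y n)).1
    rw [abs_le]
    constructor
    · refine le_limsup_of_frequently_le (Frequently.of_forall fun n => (abs_le.1 (hquot τ Y n)).1) hbdd
    · exact limsup_le_of_le hcobdd (Eventually.of_forall fun n => (abs_le.1 (hquot τ Y n)).2)
  -- at points of differentiability the derivative is `k`
  have hkderiv : ∀ (Y : Config s d (UnitAddTorus d)) (τ : ℝ), DifferentiableAt ℝ (fun τ => ut τ Y) τ →
      k τ Y = deriv (fun τ => ut τ Y) τ := by
    intro Y τ hdiff
    rw [hk]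
    simp only
    have h1 := hdiff.hasDerivAt.tendsto_slope_zero_right
    have h2 : Tendsto (fun n : ℕ => 1 / ((n : ℝ) + 1)) atTop (𝓝[>] 0) := by
      rw [tendsto_nhdsWithin_iff]
      exact ⟨tendsto_one_div_add_atTop_nhds_zero_nat, Eventually.of_forall fun n => by
        simp only [mem_Ioi]; positivity⟩
    have h3 := h1.comp h2
    refine Tendsto.limsup_eq ?_
    refine h3.congr fun n => ?_
    simp only [Function.comp_apply, smul_eq_mul, one_div, inv_inv]
    ring
  /- ### the source term and the boundary data -/
  obtain ⟨K, hK⟩ : ∃ K : ℝ → Config s d (UnitAddTorus d) → ℝ, K = fun τ Z =>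
      Φs.good.indicator (fun Z => k τ (Φs.flow (-τ) Z)) Z := ⟨_, rfl⟩
  have hKm : ∀ τ, Measurable (K τ) := fun τ => by
    rw [hK]; exact ((hkm τ).comp (Φs.measurable_flow (-τ))).indicator Φs.measurableSet_good
  have hKbd : ∀ τ Z, |K τ Z| ≤ L * Real.exp (-(β / 4) * ‖(Z i₀).2‖ ^ 2) := by
    intro τ Z
    rw [hK]
    simp only
    by_cases hZ : Z ∈ Φs.good
    · rw [indicator_of_mem hZ]
      calc |k τ (Φs.flow (-τ) Z)| ≤ L * Real.exp (-(β / 2) * configEnergy (Φs.flow (-τ) Z)) := hkbd _ _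
        _ = L * Real.exp (-(β / 2) * configEnergy Z) := by rw [Φs.configEnergy_flow hZ]
        _ ≤ L * Real.exp (-(β / 4) * ‖(Z i₀).2‖ ^ 2) :=
            mul_le_mul_of_nonneg_left (exp_neg_half_energy_le hβ.le Z i₀) hL0
    · rw [indicator_of_notMem hZ, abs_zero]; positivity
  have hsN : s < s + m := by omega
  have hbd := fun τ => exists_boundaryData (N := s + m) hε hd hsN i₀ (A₀ := L) (b := β / 4) (by positivity)
    hBadω (hKm τ) (hKbd τ)
  choose hb hhb hhbsupp using hbd
  -- the bad set of tagged configurations and the support of the data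
  obtain ⟨hSbm, hSb0⟩ := exists_badSet (d := d) (s := s) hε.ne' i₀
  have hi₀last : Fin.castSucc i₀ ≠ Fin.last s := (Fin.castSucc_lt_last i₀).ne
  refine ⟨fun t Z => ut 0 (Φs.flow (-t) Z) +
      ∫ τ in (0 : ℝ)..t, bbgkyOp (Torus.geometry d) ε (s + m) s (hb τ) (Φs.flow (-(t - τ)) Z),
    hb, {Z : Config (s + 1) d (UnitAddTorus d) |
      ‖(Torus.geometry d).sepVec (Z (Fin.last s)).1 (Z (Fin.castSucc i₀)).1‖ = ε}, ?_, ?_, ?_, ?_, ?_⟩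
  · -- measurability of the support
    have hmf : Measurable fun Z : Config (s + 1) d (UnitAddTorus d) =>
        (Torus.geometry d).sepVec (Z (Fin.last s)).1 (Z (Fin.castSucc i₀)).1 :=
      Torus.measurable_geometry_sepVec.comp
        ((measurable_pi_apply (Fin.last s)).fst.prodMk (measurable_pi_apply (Fin.castSucc i₀)).fst)
    exact measurableSet_eq_fun hmf.norm measurable_const
  · exact volume_setOf_norm_sepVec_eq hε.ne' hi₀last.symm
  · intro τ Z hZ
    have h := hhbsupp τ Z hZ
    show ‖(Torus.geometry d).sepVec (Z (Fin.last s)).1 (Z (Fin.castSucc i₀)).1‖ = ε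
    rw [Torus.norm_geometry_sepVec]
    exact h
  · -- the Duhamel identity holds by construction
    intro t Z hZ
    simp only [neg_zero, intervalIntegral.integral_same, add_zero]
    rw [Φs.flow_zero _ (Φs.mapsTo_good (-t) hZ)]
  · /- ### agreement with the marginal a.e. -/
    intro t
    -- the null sets to discard
    have hSbL : liouville (Torus.geometry d) s ε {Y : Config s d (UnitAddTorus d) | ∃ i : Fin s, i ≠ i₀ ∧
        sphereMeasure {ω : sphere (0 : EuclideanSpace ℝ d) 1 |
          Torus.euclidDist ((Torus.geometry d).translate (Y i).1 (ε • (ω : EuclideanSpace ℝ d))) (Y i₀).1 = ε} ≠ 0} = 0 := by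
      rw [liouville_eq]
      exact nonpos_iff_eq_zero.1 ((Measure.le_iff'.1 Measure.restrict_le_self _).trans hSb0.le)
    have h1 := ae_ae_flow_not_mem_torus Φs hSbm hSbL
    rw [← Φs.volume_restrict_good_eq] at h1
    have h2 := hutae t
    have h3 := hutae 0
    -- the statement along the flow: for a.e. good `Y`, at `Z = Φs_t Y`
    have hflow : ∀ᵐ Y ∂(volume.restrict Φs.good),
        ut 0 Y + ∫ τ in (0 : ℝ)..t, bbgkyOp (Torus.geometry d) ε (s + m) s (hb τ) (Φs.flow τ Y) = ut t Y := by
      filter_upwards [h1, ae_restrict_mem Φs.measurableSet_good] with Y hY hYg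
      -- Lipschitz in time, hence a.e. differentiable and absolutely continuous
      have hLip : LipschitzWith (Real.toNNReal (L * Real.exp (-(β / 2) * configEnergy Y))) fun τ => ut τ Y := by
        refine LipschitzWith.of_dist_le_mul fun τ τ' => ?_
        rw [Real.dist_eq, Real.dist_eq, Real.coe_toNNReal _ (by positivity)]
        exact hutL Y τ τ'
      have hdiff := hLip.ae_differentiableAt (μ := volume)
      have hFTC := (hLip.lipschitzOnWith (s := uIcc 0 t)).absolutelyContinuousOnInterval.integral_deriv_eq_sub
      -- the integrand is `k τ Y` for a.e. `τ`
      have hint : ∫ τ in (0 : ℝ)..t, bbgkyOp (Torus.geometry d) ε (s + m) s (hb τ) (Φs.flow τ Y) =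
          ∫ τ in (0 : ℝ)..t, deriv (fun τ => ut τ Y) τ := by
        refine intervalIntegral.integral_congr_ae ?_
        filter_upwards [hY, hdiff] with τ hτ hτd _
        rw [hhb τ (Φs.flow τ Y), indicator_of_mem (show Φs.flow τ Y ∈ _ᶜ from hτ), hK]
        simp only
        rw [indicator_of_mem (Φs.mapsTo_good τ hYg), Φs.flow_neg_flow τ hYg]
        exact hkderiv Y τ hτd
      rw [hint, hFTC]
      ring
    -- transfer to a.e. `Z`
    have hbadnull : volume {Y ∈ Φs.good | ¬ (ut 0 Y +
        ∫ τ in (0 : ℝ)..t, bbgkyOp (Torus.geometry d) ε (s + m) s (hb τ) (Φs.flow τ Y) = ut t Y ∧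
          ut t Y = nthMarginal (s + m) s (ΦN.good.indicator fun z => W (ΦN.flow (-t) z)) (Φs.flow t Y))} = 0 := by
      have h := hflow.and h2
      rw [ae_iff, Measure.restrict_apply' Φs.measurableSet_good] at h
      rw [← h]
      congr 1
      ext Y
      simp only [mem_setOf_eq, mem_inter_iff]
      tauto
    have himg := Φs.liouville_image_null t (S := {Y ∈ Φs.good | ¬ (ut 0 Y +
        ∫ τ in (0 : ℝ)..t, bbgkyOp (Torus.geometry d) ε (s + m) s (hb τ) (Φs.flow τ Y) = ut t Y ∧
          ut t Y = nthMarginal (s + m) s (ΦN.good.indicator fun z => W (ΦN.flow (-t) z)) (Φs.flow t Y))})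
      (fun Y hY => hY.1) ((Φs.liouville_eq_zero_iff_of_subset_good (fun Y hY => hY.1)).2 hbadnull)
    rw [← Φs.volume_restrict_good_eq, Measure.restrict_apply' Φs.measurableSet_good] at himg
    rw [ae_iff]
    refine measure_mono_null (fun Z hZ => ?_) himg
    simp only [mem_setOf_eq, Classical.not_imp] at hZ
    obtain ⟨hZg, hne⟩ := hZ
    refine ⟨⟨Φs.flow (-t) Z, ⟨Φs.mapsTo_good (-t) hZg, fun h => hne ?_⟩, Φs.flow_flow_neg t hZg⟩, hZg⟩
    -- `Z = Φs_t Y` with `Y = Φs_{-t} Z`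
    obtain ⟨hY1, hY2⟩ := h
    rw [Φs.flow_flow_neg t hZg] at hY2
    rw [← hY2, ← hY1]
    congr 1
    refine intervalIntegral.integral_congr fun τ _ => ?_
    rw [← Φs.flow_add τ (-t) Z hZg]
    congr 2
    ring

end Level

end

end Literature.MathematicalPhysics.KineticTheory
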